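import Summits.CriticalPhenomena.PercolationContinuityZ3.Theorems.PercNearOneGluingNoHeavyLowerTailCILPendantPeeling
import Summits.CriticalPhenomena.PercolationContinuityZ3.Theorems.PercNearOneGluingNoHeavyLowerTailCILSeriesReduction
import Summits.CriticalPhenomena.PercolationContinuityZ3.Theorems.PercNearOneGluingAdditiveGluingVariants2083
import HarnessLib

/-!
# QUANT lane R8, front "FAR beyond trees", layer one — the PENDANT-OBSERVER reduction

builds on p205010 (kernel theorem, internal audit signed; external expert review pending)

Support file (`--supports stmt-CriticalPhenomena-4575`), seat `prim-quant-p1` (gen 18); memo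
`run/shared/lean/prim/quant/prim-quant-p1-g18/FOR-LEAD-UNICYCLIC-TREES.md` §3 (iii)(b) (kernel plan §6, file F-C ingredient (i)).
Standard axioms; no sorries; no definitions.

If the observer `o ∉ A` is PENDANT — its only positive-weight pair is `s(o,c)`, of weight `g` — then almost surely `o ↔ a` iff `s(o,c)` is open and
`c ↔ a`, the latter being independent of `s(o,c)`.  Hence
* `Quant.Bundle.real_openConn_of_pendant_observer` — `P(o ↔ a) = g · P(c ↔ a)` (`a ≠ o`);
* `Quant.Bundle.real_card_le_one_of_pendant_observer` — `P(N_o ≤ 1) = (1 − g) + g · P(N_c ≤ 1)` (`N_x = #{a ∈ A : x ↔ a}`);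
* **`Quant.Bundle.layerOne_of_pendant_observer`** — the layer-one FAR instance at `o` follows from the layer-one FAR instance at `c`
  (`2 < Σ P(c ↔ a)`, `P(c ↮ a) ≤ t' ⟹ P(N_c ≤ 1) ≤ t'`, used with `t' = (t − (1 − g))/g`).
So for FAR at layer one on unicyclic supports the observer may be assumed ON the cycle (move it along its stalk), as in memo §3.
[cite: Grimmett1999, §1.3 p. 10; §2.2] (product measure); [cite: KozmaNitzan2024, Conjecture 3 (p. 15)] (the rows served); [this work].
-/

noncomputable section

namespace Summit.CriticalPhenomena.PercolationContinuityZ3.Theorems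

namespace Quant

namespace Bundle

open Finset MeasureTheory Set
open Literature.Probability.LatticeModels
open Literature.Probability.Percolation
open scoped Classical

variable {n : ℕ}

section Observer

variable (w : Sym2 (Fin n) → unitInterval) {o c : Fin n} (hoc : o ≠ c) (hpend : ∀ x : Fin n, x ≠ o → x ≠ c → w s(o, x) = 0)
include hoc hpend

/-- In the support of `w`, with the pair `s(o,c)` removed, no pair at `o` is open. [this work] -/
theorem closed_at_observer (ω : BondConfig (Fin n)) :
    ∀ v : Fin n, v ≠ o → s(o, v) ∉ (ω ∩ {e | w e ≠ 0}) \ {s(o, c)} := by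
  intro v hv hmem
  have hne : s(o, v) ≠ s(o, c) := fun h => hmem.2 (by rw [h]; exact Set.mem_singleton _)
  have hvc : v ≠ c := by
    intro h; subst h; exact hne rfl
  exact hmem.1.2 (hpend v hv hvc)

/-- **Reachability from a pendant observer** (inside the support): `o ↔ a` iff `s(o,c)` is open and `c ↔ a` without that pair (`a ≠ o`).
[this work] -/
theorem reach_pendant_observer_iff (ω : BondConfig (Fin n)) {a : Fin n} (hao : a ≠ o) :
    (openGraph (ω ∩ {e | w e ≠ 0})).Reachable o a ↔
      s(o, c) ∈ ω ∩ {e | w e ≠ 0} ∧ (openGraph ((ω ∩ {e | w e ≠ 0}) \ {s(o, c)})).Reachable c a := by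
  set η : BondConfig (Fin n) := ω ∩ {e | w e ≠ 0} with hη
  have hclosed := closed_at_observer w hoc hpend ω
  constructor
  · intro h
    obtain ⟨q⟩ := h
    cases q with
    | nil => exact absurd rfl hao
    | cons hadj q' =>
      rename_i x
      rw [openGraph_adj] at hadj
      obtain ⟨hmem, hox⟩ := hadj
      -- the first pair is `s(o,c)`
      have hxc : x = c := by
        by_contra hxc
        exact hmem.2 (hpend x (Ne.symm hox) hxc)
      subst hxc
      refine ⟨hmem, ?_⟩
      -- the rest of the walk may be taken off `s(o,c)`: that pair is pendant
      have hins : insert s(o, x) (η \ {s(o, x)}) = η := by rw [Set.insert_sdiff_singleton, Set.insert_eq_of_mem hmem]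
      have hreach : (openGraph (insert s(o, x) (η \ {s(o, x)}))).Reachable x a := by rw [hins]; exact ⟨q'⟩
      exact (HullPort.reachable_insert_pendant_iff hoc hclosed hoc.symm hao).1 hreach
  · rintro ⟨hmem, hca⟩
    have hadj : (openGraph η).Adj o c := by rw [openGraph_adj]; exact ⟨hmem, hoc⟩
    exact hadj.reachable.trans (hca.mono (SimpleGraph.fromEdgeSet_mono Set.sdiff_subset))

/-- Reachability from `c` does not use the pendant pair (`a ≠ o`). [this work] -/
theorem reach_c_iff (ω : BondConfig (Fin n)) {a : Fin n} (hao : a ≠ o) :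
    (openGraph (ω ∩ {e | w e ≠ 0})).Reachable c a ↔ (openGraph ((ω ∩ {e | w e ≠ 0}) \ {s(o, c)})).Reachable c a := by
  set η : BondConfig (Fin n) := ω ∩ {e | w e ≠ 0} with hη
  have hclosed := closed_at_observer w hoc hpend ω
  by_cases hmem : s(o, c) ∈ η
  · have hins : insert s(o, c) (η \ {s(o, c)}) = η := by rw [Set.insert_sdiff_singleton, Set.insert_eq_of_mem hmem]
    conv_lhs => rw [← hins]
    exact HullPort.reachable_insert_pendant_iff hoc hclosed hoc.symm hao
  · have : η \ {s(o, c)} = η := Set.sdiff_singleton_eq_self hmem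
    rw [this]

omit hoc hpend in
/-- Events read off the support restricted away from `s(o,c)` are determined by the pairs other than `s(o,c)`. [this work] -/
theorem determinedBy_erase (P : BondConfig (Fin n) → Prop) :
    DeterminedBy {ω : BondConfig (Fin n) | P ((ω ∩ {e | w e ≠ 0}) \ {s(o, c)})}
      (↑((Finset.univ : Finset (Sym2 (Fin n))).erase s(o, c)) : Set (Sym2 (Fin n))) := by
  rw [determinedBy_iff]
  intro ω ω' h
  have hset : (ω ∩ {e | w e ≠ 0}) \ {s(o, c)} = (ω' ∩ {e | w e ≠ 0}) \ {s(o, c)} := by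
    ext e
    simp only [Set.mem_sdiff, Set.mem_inter_iff, Set.mem_setOf_eq, Set.mem_singleton_iff]
    by_cases he : e = s(o, c)
    · simp [he]
    · have hmem : e ∈ (↑((Finset.univ : Finset (Sym2 (Fin n))).erase s(o, c)) : Set (Sym2 (Fin n))) := by
        simp [he]
      have key : e ∈ ω ↔ e ∈ ω' :=
        ⟨fun h1 => (((Set.ext_iff.1 h) e).1 ⟨h1, hmem⟩).1, fun h1 => (((Set.ext_iff.1 h) e).2 ⟨h1, hmem⟩).1⟩
      simp [key, he]
  simp only [mem_setOf_eq, hset]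

/-- If `w s(o,c) = 0` the pendant observer is isolated: `P(o ↔ a) = 0` for `a ≠ o`. [this work] -/
theorem real_openConn_eq_zero_of_isolated_observer (hg : w s(o, c) = 0) {a : Fin n} (hao : a ≠ o) :
    (prodBernoulli w).real (openConn o a) = 0 := by
  rw [PendantPeeling.measureReal_eq_inter_support w (openConn o a)]
  have : {ω : BondConfig (Fin n) | ω ∩ {e | w e ≠ 0} ∈ openConn o a} = ∅ := by
    ext ω
    simp only [mem_setOf_eq, Set.mem_empty_iff_false, iff_false]
    intro h
    have h' : (openGraph (ω ∩ {e | w e ≠ 0})).Reachable o a := h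
    rw [reach_pendant_observer_iff w hoc hpend ω hao] at h'
    exact h'.1.2 hg
  rw [this, measureReal_empty]

/-- **Marginals from a pendant observer**: `P(o ↔ a) = g · P(c ↔ a)` for `a ≠ o`. [this work] -/
theorem real_openConn_of_pendant_observer {a : Fin n} (hao : a ≠ o) :
    (prodBernoulli w).real (openConn o a) = (w s(o, c) : ℝ) * (prodBernoulli w).real (openConn c a) := by
  have hmeas : ∀ U : Set (BondConfig (Fin n)), MeasurableSet U := fun U => (Set.toFinite U).measurableSet
  by_cases hg : w s(o, c) = 0
  · rw [real_openConn_eq_zero_of_isolated_observer w hoc hpend hg hao, hg]; simp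
  set R : Set (BondConfig (Fin n)) := {ω | (openGraph ((ω ∩ {e | w e ≠ 0}) \ {s(o, c)})).Reachable c a} with hR
  have h1 : (prodBernoulli w).real (openConn o a) = (prodBernoulli w).real ({ω | s(o, c) ∈ ω} ∩ R) := by
    rw [PendantPeeling.measureReal_eq_inter_support w (openConn o a)]
    congr 1
    ext ω
    simp only [mem_setOf_eq, Set.mem_inter_iff, hR]
    rw [show (ω ∩ {e | w e ≠ 0} ∈ openConn o a) = (openGraph (ω ∩ {e | w e ≠ 0})).Reachable o a from rfl,
      reach_pendant_observer_iff w hoc hpend ω hao]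
    simp only [Set.mem_inter_iff, Set.mem_setOf_eq, ne_eq, hg, not_false_eq_true, and_true]
  have h2 : (prodBernoulli w).real (openConn c a) = (prodBernoulli w).real R := by
    rw [PendantPeeling.measureReal_eq_inter_support w (openConn c a)]
    congr 1
    ext ω
    simp only [mem_setOf_eq, hR]
    exact reach_c_iff w hoc hpend ω hao
  rw [h1, h2, hR, prodBernoulli_real_inter_of_determinedBy_disjoint w
    (Finset.disjoint_singleton_left.2 (Finset.notMem_erase _ _)) (var2083_det_mem s(o, c))
    (determinedBy_erase w fun η => (openGraph η).Reachable c a) (hmeas _) (hmeas _), prodBernoulli_real_setOf_mem]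

/-- **The light event from a pendant observer**: `P(N_o ≤ 1) = (1 − g) + g · P(N_c ≤ 1)` for `o ∉ A`. [this work] -/
theorem real_card_le_one_of_pendant_observer (A : Finset (Fin n)) (hoA : o ∉ A) :
    (prodBernoulli w).real {ω : BondConfig (Fin n) | (A.filter fun a => ω ∈ openConn o a).card ≤ 1} =
      (1 - (w s(o, c) : ℝ)) + (w s(o, c) : ℝ) *
        (prodBernoulli w).real {ω : BondConfig (Fin n) | (A.filter fun a => ω ∈ openConn c a).card ≤ 1} := by
  have hmeas : ∀ U : Set (BondConfig (Fin n)), MeasurableSet U := fun U => (Set.toFinite U).measurableSet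
  set M : BondConfig (Fin n) → ℕ := fun ω => (A.filter fun a => (openGraph ((ω ∩ {e | w e ≠ 0}) \ {s(o, c)})).Reachable c a).card
    with hM
  -- pointwise: the count from `o` in the support
  have hcount : ∀ ω : BondConfig (Fin n), (A.filter fun a => ω ∩ {e | w e ≠ 0} ∈ openConn o a).card =
      if s(o, c) ∈ ω ∩ {e | w e ≠ 0} then M ω else 0 := by
    intro ω
    by_cases hmem : s(o, c) ∈ ω ∩ {e | w e ≠ 0}
    · rw [if_pos hmem, hM]
      refine congrArg _ (filter_congr fun a ha => ?_)
      have hao : a ≠ o := fun h => hoA (h ▸ ha)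
      rw [show (ω ∩ {e | w e ≠ 0} ∈ openConn o a) = (openGraph (ω ∩ {e | w e ≠ 0})).Reachable o a from rfl,
        reach_pendant_observer_iff w hoc hpend ω hao]
      simp only [hmem, true_and]
    · rw [if_neg hmem, card_eq_zero, filter_eq_empty_iff]
      intro a ha h
      have hao : a ≠ o := fun h => hoA (h ▸ ha)
      have h' : (openGraph (ω ∩ {e | w e ≠ 0})).Reachable o a := h
      rw [reach_pendant_observer_iff w hoc hpend ω hao] at h'
      exact hmem h'.1
  -- the count from `c`
  have hTc : (prodBernoulli w).real {ω : BondConfig (Fin n) | (A.filter fun a => ω ∈ openConn c a).card ≤ 1} =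
      (prodBernoulli w).real {ω | M ω ≤ 1} := by
    rw [PendantPeeling.measureReal_eq_inter_support w]
    congr 1
    ext ω
    simp only [mem_setOf_eq, hM]
    have : (A.filter fun a => ω ∩ {e | w e ≠ 0} ∈ openConn c a) =
        (A.filter fun a => (openGraph ((ω ∩ {e | w e ≠ 0}) \ {s(o, c)})).Reachable c a) := by
      refine filter_congr fun a ha => ?_
      have hao : a ≠ o := fun h => hoA (h ▸ ha)
      exact reach_c_iff w hoc hpend ω hao
    rw [this]
  have hdetM : DeterminedBy {ω : BondConfig (Fin n) | M ω ≤ 1} (↑((Finset.univ : Finset (Sym2 (Fin n))).erase s(o, c)) : Set (Sym2 (Fin n))) :=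
    determinedBy_erase w fun η => (A.filter fun a => (openGraph η).Reachable c a).card ≤ 1
  by_cases hg : w s(o, c) = 0
  · -- isolated observer: `N_o = 0` almost surely
    have h0 : (prodBernoulli w).real {ω : BondConfig (Fin n) | (A.filter fun a => ω ∈ openConn o a).card ≤ 1} = 1 := by
      rw [PendantPeeling.measureReal_eq_inter_support w]
      have : {ω : BondConfig (Fin n) | ω ∩ {e | w e ≠ 0} ∈ {ω : BondConfig (Fin n) | (A.filter fun a => ω ∈ openConn o a).card ≤ 1}} =
          Set.univ := by
        ext ω
        simp only [mem_setOf_eq, Set.mem_univ, iff_true, hcount ω]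
        have : s(o, c) ∉ ω ∩ {e | w e ≠ 0} := fun h => h.2 hg
        rw [if_neg this]; omega
      rw [this]; simp
    rw [h0, hg]; simp
  · have hT : (prodBernoulli w).real {ω : BondConfig (Fin n) | (A.filter fun a => ω ∈ openConn o a).card ≤ 1} =
        (prodBernoulli w).real ({ω | s(o, c) ∉ ω} ∪ ({ω | s(o, c) ∈ ω} ∩ {ω | M ω ≤ 1})) := by
      rw [PendantPeeling.measureReal_eq_inter_support w]
      congr 1
      ext ω
      simp only [mem_setOf_eq, Set.mem_union, Set.mem_inter_iff]
      rw [hcount ω]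
      by_cases hmem : s(o, c) ∈ ω
      · have hmem' : s(o, c) ∈ ω ∩ {e | w e ≠ 0} := ⟨hmem, hg⟩
        rw [if_pos hmem']
        simp only [hmem, not_true_eq_false, true_and, false_or]
      · have hmem' : s(o, c) ∉ ω ∩ {e | w e ≠ 0} := fun h => hmem h.1
        rw [if_neg hmem']
        simp only [hmem, not_false_eq_true, false_and, or_false, zero_le_one]
    have hdisj : Disjoint {ω : BondConfig (Fin n) | s(o, c) ∉ ω} ({ω | s(o, c) ∈ ω} ∩ {ω | M ω ≤ 1}) := by
      rw [Set.disjoint_left]; rintro ω h1 ⟨h2, -⟩; exact h1 h2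
    rw [hT, measureReal_union hdisj (hmeas _), prodBernoulli_real_setOf_notMem,
      prodBernoulli_real_inter_of_determinedBy_disjoint w (Finset.disjoint_singleton_left.2 (Finset.notMem_erase _ _))
        (var2083_det_mem s(o, c)) hdetM (hmeas _) (hmeas _),
      prodBernoulli_real_setOf_mem, hTc]

/-- **The layer-one FAR instance transfers from the neighbour to a pendant observer** (`o ∉ A`): if at `c`
`2 < Σ_{a∈A} P(c ↔ a)` and `P(c ↮ a) ≤ t'` (all `a ∈ A`) imply `P(N_c ≤ 1) ≤ t'` for every `t'`, then at `o`
`2 < Σ_{a∈A} P(o ↔ a)` and `P(o ↮ a) ≤ t` imply `P(N_o ≤ 1) ≤ t`. [this work] -/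
theorem layerOne_of_pendant_observer (A : Finset (Fin n)) (hoA : o ∉ A)
    (hFARc : ∀ t' : ℝ, (2 : ℝ) < ∑ a ∈ A, (prodBernoulli w).real (openConn c a) →
      (∀ a ∈ A, (prodBernoulli w).real (openConn c a : Set (BondConfig (Fin n)))ᶜ ≤ t') →
      (prodBernoulli w).real {ω : BondConfig (Fin n) | (A.filter fun a => ω ∈ openConn c a).card ≤ 1} ≤ t')
    (t : ℝ) (hmean : (2 : ℝ) < ∑ a ∈ A, (prodBernoulli w).real (openConn o a))
    (hcut : ∀ a ∈ A, (prodBernoulli w).real (openConn o a : Set (BondConfig (Fin n)))ᶜ ≤ t) :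
    (prodBernoulli w).real {ω : BondConfig (Fin n) | (A.filter fun a => ω ∈ openConn o a).card ≤ 1} ≤ t := by
  have hmeas : ∀ U : Set (BondConfig (Fin n)), MeasurableSet U := fun U => (Set.toFinite U).measurableSet
  set g : ℝ := (w s(o, c) : ℝ) with hgdef
  have hg0 : 0 ≤ g := (w s(o, c)).2.1
  have hg1 : g ≤ 1 := (w s(o, c)).2.2
  have hmarg : ∀ a ∈ A, (prodBernoulli w).real (openConn o a) = g * (prodBernoulli w).real (openConn c a) :=
    fun a ha => real_openConn_of_pendant_observer w hoc hpend fun h => hoA (h ▸ ha)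
  have hsum : ∑ a ∈ A, (prodBernoulli w).real (openConn o a) = g * ∑ a ∈ A, (prodBernoulli w).real (openConn c a) := by
    rw [Finset.mul_sum]; exact Finset.sum_congr rfl hmarg
  have hgpos : 0 < g := by
    by_contra h
    have hg' : g = 0 := le_antisymm (not_lt.1 h) hg0
    rw [hsum, hg'] at hmean; simp at hmean; linarith
  -- the instance at `c` with `t' = 1 − (1 − t)/g`
  set t' : ℝ := 1 - (1 - t) / g with ht'
  have hmean_c : (2 : ℝ) < ∑ a ∈ A, (prodBernoulli w).real (openConn c a) := by
    have h2 : (2 : ℝ) < g * ∑ a ∈ A, (prodBernoulli w).real (openConn c a) := by rw [← hsum]; exact hmean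
    have hS0 : 0 ≤ ∑ a ∈ A, (prodBernoulli w).real (openConn c a) := Finset.sum_nonneg fun _ _ => measureReal_nonneg
    nlinarith
  have hcut_c : ∀ a ∈ A, (prodBernoulli w).real (openConn c a : Set (BondConfig (Fin n)))ᶜ ≤ t' := by
    intro a ha
    have h1 := hcut a ha
    rw [probReal_compl_eq_one_sub (hmeas _), hmarg a ha] at h1
    rw [probReal_compl_eq_one_sub (hmeas _), ht']
    -- `1 − g q ≤ t` gives `q ≥ (1 − t)/g`
    have : (1 - t) / g ≤ (prodBernoulli w).real (openConn c a) := by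
      rw [div_le_iff₀ hgpos]; linarith
    linarith
  have hc := hFARc t' hmean_c hcut_c
  rw [real_card_le_one_of_pendant_observer w hoc hpend A hoA]
  have : g * (prodBernoulli w).real {ω : BondConfig (Fin n) | (A.filter fun a => ω ∈ openConn c a).card ≤ 1} ≤ g * t' :=
    mul_le_mul_of_nonneg_left hc hg0
  have ht'g : g * t' = g - (1 - t) := by rw [ht']; field_simp
  linarith

end Observer

/-! ## The trivial case `o ∈ A` (appended, p1 g18) -/

/-- **Layer one with the observer a relay.**  If `o ∈ A` then `N = #{a ∈ A : o ↔ a} ≥ 1` surely, and `2 < Σ_{a∈A} P(o ↔ a)` forces another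
relay `a ≠ o`, with `{o ↔ a} ⊆ {N ≥ 2}`; so `P(N ≤ 1) ≤ P(o ↮ a) ≤ t`. [this work] -/
theorem layerOne_of_observer_mem (w : Sym2 (Fin n) → unitInterval) (A : Finset (Fin n)) {o : Fin n} (hoA : o ∈ A) (t : ℝ)
    (hmean : (2 : ℝ) < ∑ a ∈ A, (prodBernoulli w).real (openConn o a))
    (hcut : ∀ a ∈ A, (prodBernoulli w).real (openConn o a : Set (BondConfig (Fin n)))ᶜ ≤ t) :
    (prodBernoulli w).real {ω : BondConfig (Fin n) | (A.filter fun a => ω ∈ openConn o a).card ≤ 1} ≤ t := by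
  have hmeas : ∀ U : Set (BondConfig (Fin n)), MeasurableSet U := fun U => (Set.toFinite U).measurableSet
  -- another relay `a ≠ o`
  have hex : ∃ a ∈ A, a ≠ o := by
    by_contra h
    push Not at h
    have hA : A = {o} := Finset.eq_singleton_iff_unique_mem.2 ⟨hoA, h⟩
    rw [hA, Finset.sum_singleton] at hmean
    have h1 : (prodBernoulli w).real (openConn o o : Set (BondConfig (Fin n))) ≤ 1 := measureReal_le_one
    linarith
  obtain ⟨a, haA, hao⟩ := hex
  -- `{o ↔ a} ⊆ {N ≥ 2}`, i.e. `{N ≤ 1} ⊆ {o ↔ a}ᶜ`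
  have hsub : {ω : BondConfig (Fin n) | (A.filter fun b => ω ∈ openConn o b).card ≤ 1} ⊆ (openConn o a : Set (BondConfig (Fin n)))ᶜ := by
    intro ω hω hωa
    simp only [mem_setOf_eq] at hω
    have hpair : ({o, a} : Finset (Fin n)) ⊆ A.filter fun b => ω ∈ openConn o b := by
      intro b hb
      rcases Finset.mem_insert.1 hb with rfl | hb
      · exact Finset.mem_filter.2 ⟨hoA, (SimpleGraph.Reachable.refl _ : (openGraph ω).Reachable b b)⟩
      · rw [Finset.mem_singleton] at hb; subst hb
        exact Finset.mem_filter.2 ⟨haA, hωa⟩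
    have h2 : 2 ≤ (A.filter fun b => ω ∈ openConn o b).card := by
      calc 2 = ({o, a} : Finset (Fin n)).card := by rw [Finset.card_pair hao.symm]
        _ ≤ _ := Finset.card_le_card hpair
    omega
  exact (measureReal_mono hsub).trans (hcut a haA)

end Bundle

end Quant

end Summit.CriticalPhenomena.PercolationContinuityZ3.Theorems
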